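import Mathlib
import Summits.PneNP.PneNP.Theorems.PositionalGamesMpgHardNpLanguagePotential
import Summits.PneNP.PneNP.Theorems.PositionalGamesMpgHardNpLanguageSemantics

/-!
# Route PositionalGames — support item `MpgHardNpLanguage` (stmt-PneNP-1300): completeness of the certificate

Helper file for the proof of `Summit.PneNP.PneNP.Theses.PositionalGames.MpgHardNpLanguage`:
the converse of `mpgWin_of_mpgQ` (`…Semantics.lean`). If Even wins the threshold mean-payoff game (`MpgWin n o v x`,
the route's inline predicate) then some witness tables pass the first-order check `mpgQ` on
`gameTab n o v x` (`mpgQ_of_mpgWin`), whence `exists_mpgQ_iff : (∃ W, mpgQ (gameTab n o v x) W)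
↔ MpgWin n o v x`.

The witness (`witTab`, `…Defs.lean`): Even's winning positional strategy `σ`; if some Odd vertex has no legal
move, `Q2` holds outright; otherwise the successor relation `E'` (Even follows `σ`, Odd keeps
every legal edge) is total and — because every legal Odd strategy is a choice function of `E'`
whose lasso Even survives — satisfies the cycle condition of `…Potential.lean` for the weights
`c(u) = 2·w(u) - 2ⁿ`, so `exists_potential` gives a successor-closed set `R ∋ v` and a potential
`φ`, `|φ| ≤ n·2ⁿ`; the tables carry `R`, the rows of `Φ = φ + n·2ⁿ ≥ 0`, and the school
additions `Φ + 2ⁿ`, `Φ + 2·w`, `(Φ b + 2ⁿ) + d = Φ a + 2·w(a)` (`…Arith.lean`), all fitting in the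
`2n + 2` bit positions of the universe. Zwick–Paterson 1996 §2 / folklore.
-/

namespace Summit.PneNP.PneNP.Theorems.MpgNP

set_option linter.dupNamespace false -- `Summit.PneNP.PneNP.…`: summit = sub-problem (D-0017)

open Literature.ModelTheory.FiniteModelTheory Literature.Computability.Cryptography
open Literature.Computability.Complexity.ArithCkt Finset Filter

variable {n : ℕ}

section Witness

variable (o : Fin n → Bool) (v : Fin n) (x : (Fin n × Fin n) ⊕ (Fin n × Fin n) → Bool)
  (σ : Fin n → Fin n) (Rset : Set (Fin n)) (PhiN : Fin (usize n) → ℕ)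

/-- `Sg (vx u) (vx w) ↔ w = σ u`. [folklore] -/
theorem sg_wit_iff (u w : Fin n) : sg (witTab o v x σ Rset PhiN) (vx u) (vx w) ↔ w = σ u := by
  unfold sg
  show (if ha : ((vx u : Fin (usize n)) : ℕ) < n then
    decide (((vx w : Fin (usize n)) : ℕ) = σ ⟨_, ha⟩) else false) = true ↔ _
  rw [dif_pos (by exact u.2), decide_eq_true_iff]
  exact ⟨fun h => Fin.ext h, fun h => by rw [h]; rfl⟩

open scoped Classical in
/-- `Rr a ↔ a` is a vertex in `R`. [folklore] -/
theorem rr_wit_iff (a : Fin (usize n)) :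
    rr (witTab o v x σ Rset PhiN) a ↔ ∃ h : (a : ℕ) < n, (⟨a, h⟩ : Fin n) ∈ Rset := by
  unfold rr
  show (if ha : (a : ℕ) < n then decide (⟨_, ha⟩ ∈ Rset) else false) = true ↔ _
  by_cases ha : (a : ℕ) < n
  · rw [dif_pos ha, decide_eq_true_iff]
    exact ⟨fun h => ⟨ha, h⟩, fun ⟨_, h⟩ => h⟩
  · rw [dif_neg ha]
    simp [ha]

/-- `Rr (vx u) ↔ u ∈ R`. [folklore] -/
theorem rr_wit_vx_iff (u : Fin n) : rr (witTab o v x σ Rset PhiN) (vx u) ↔ u ∈ Rset := by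
  rw [rr_wit_iff]
  exact ⟨fun ⟨_, h⟩ => h, fun h => ⟨u.2, h⟩⟩

/-- `Q1` holds for the witness of a LEGAL Even strategy. [folklore] -/
theorem q1_wit (hσ : ∀ u, o u = true → x (Sum.inl (u, σ u)) = true) :
    Q1 (gameTab n o v x) (witTab o v x σ Rset PhiN) := by
  intro a ha hao
  obtain ⟨u, rfl⟩ := exists_eq_vx (n := n) ((isV_iff o v x a).1 ha)
  have hu := (ow_vx_iff o v x u).1 hao
  exact ⟨vx (σ u), (EP_vx_iff o v x _ u (σ u)).2 (Or.inl ⟨hu, (sg_wit_iff o v x σ Rset PhiN u _).2 rfl, hσ u hu⟩)⟩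

end Witness

/-! ### Arithmetic of the universe size -/

/-- `2·(n·2ⁿ) + 2·2ⁿ ≤ 2^(2n+2)`: every certified number fits in the universe. [folklore] -/
theorem budget_le (n : ℕ) : 2 * (n * 2 ^ n) + 2 * 2 ^ n ≤ 2 ^ usize n := by
  have h1 : n + 1 ≤ 2 ^ (n + 1) :=
    (Nat.succ_le_of_lt Nat.lt_two_pow_self).trans (Nat.pow_le_pow_right (by norm_num) (Nat.le_succ n))
  calc 2 * (n * 2 ^ n) + 2 * 2 ^ n = (n + 1) * 2 ^ (n + 1) := by ring
    _ ≤ 2 ^ (n + 1) * 2 ^ (n + 1) := Nat.mul_le_mul_right _ h1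
    _ = 2 ^ usize n := by rw [← pow_add]; unfold usize; ring_nf

/-! ### Completeness -/

section Complete

variable (o : Fin n → Bool) (v : Fin n) (x : (Fin n × Fin n) ⊕ (Fin n × Fin n) → Bool)

open scoped Classical in
/-- **The cycle condition holds in the Odd arena of a winning Even strategy**: every choice
function of `oddArena σ` is a legal Odd strategy (merged with `σ` it is itself), so the route's
winning condition `2ⁿ·|C| ≤ 2·Σ_C w` on its lasso is `Σ_{[i,j)} (2w - 2ⁿ) ≥ 0` on a first
repetition window. [cite: ZwickPaterson1996, §2] -/
theorem cycleCondition_oddArena (σ : Fin n → Fin n)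
    (H : ∀ τ : Fin n → Fin n, (∀ u, o u = false → x (Sum.inl (u, τ u)) = false) →
      let C : Finset (Fin n) := Finset.univ.filter fun u : Fin n =>
        ∃ᶠ t : ℕ in Filter.atTop, (fun w : Fin n => if o w = true then σ w else τ w)^[t] v = u
      2 ^ n * C.card ≤ 2 * ∑ u ∈ C, ∑ j : Fin n, if x (Sum.inr (u, j)) = true then 2 ^ (j : ℕ) else 0) :
    CycleCondition (oddArena o x σ) (fun u => 2 * (wt x u : ℤ) - 2 ^ n) v := by
  classical
  intro f hf i j hij hrep hinj
  have hτ : ∀ u, o u = false → x (Sum.inl (u, f u)) = false := fun u hu => by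
    rcases hf u with ⟨h, -⟩ | ⟨-, h⟩
    · rw [hu] at h; exact absurd h (by decide)
    · exact h
  have hfg : (fun w : Fin n => if o w = true then σ w else f w) = f := by
    funext w
    by_cases hw : o w = true
    · rcases hf w with ⟨-, h⟩ | ⟨h, -⟩
      · rw [if_pos hw, h]
      · rw [hw] at h; exact absurd h (by decide)
    · rw [if_neg hw]
  have hwin := H f hτ
  simp only [hfg] at hwin
  set C : Finset (Fin n) := Finset.univ.filter fun u : Fin n => ∃ᶠ t : ℕ in Filter.atTop, f^[t] v = u
    with hCdef
  have hC : ∀ u, u ∈ C ↔ ∃ᶠ t in atTop, f^[t] v = u := fun u => by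
    simp only [hCdef, Finset.mem_filter, Finset.mem_univ, true_and]
  have hinj' : ∀ s t, i ≤ s → s < j → i ≤ t → t < j → f^[s] v = f^[t] v → s = t :=
    fun s t _ hs _ ht hst => hinj s t hs ht hst
  rw [card_cycle_eq f v hij hrep hinj' C hC, sum_cycle_eq f v hij hrep hinj' C hC] at hwin
  change 2 ^ n * (j - i) ≤ 2 * ∑ t ∈ Ico i j, wt x (f^[t] v) at hwin
  have hwin' : (2 : ℤ) ^ n * ((j - i : ℕ) : ℤ) ≤ 2 * ∑ t ∈ Ico i j, (wt x (f^[t] v) : ℤ) := by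
    exact_mod_cast hwin
  rw [Finset.sum_sub_distrib, Finset.sum_const, Nat.card_Ico, ← Finset.mul_sum, nsmul_eq_mul]
  linarith

/-- **Completeness of the certificate.** If Even wins, some witness tables pass the first-order
check on the tables of the game. [cite: ZwickPaterson1996, §2 (potentials / cycle means)] -/
theorem mpgQ_of_mpgWin (h : MpgWin n o v x) : ∃ W, mpgQ (gameTab n o v x) W := by
  classical
  obtain ⟨σ, hσ, H⟩ := h
  by_cases hdead : ∃ u : Fin n, o u = false ∧ ∀ w, x (Sum.inl (u, w)) = true
  · -- an Odd dead end: `Q2`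
    obtain ⟨u, hu, hall⟩ := hdead
    refine ⟨witTab o v x σ ∅ (fun _ => 0), q1_wit o v x σ ∅ _ hσ, Or.inl ⟨vx u, isV_vx o v x u, ?_, ?_⟩⟩
    · rw [ow_vx_iff, hu]; decide
    · intro b hb
      obtain ⟨w, rfl⟩ := exists_eq_vx (n := n) ((isV_iff o v x b).1 hb.2.1)
      rcases (EP_vx_iff o v x _ u w).1 hb with ⟨h, -⟩ | ⟨-, h⟩
      · rw [hu] at h; exact absurd h (by decide)
      · rw [hall w] at h; exact absurd h (by decide)
  · -- no Odd dead end: potentials (`Q3`)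
    push Not at hdead
    have htot : ∀ u, ∃ w, oddArena o x σ u w := by
      intro u
      by_cases hu : o u = true
      · exact ⟨σ u, Or.inl ⟨hu, rfl⟩⟩
      · have hu' : o u = false := by simpa using hu
        obtain ⟨w, hw⟩ := hdead u hu'
        exact ⟨w, Or.inr ⟨hu', by simpa using hw⟩⟩
    have hB : ∀ u, |(2 * (wt x u : ℤ) - 2 ^ n)| ≤ 2 ^ n := fun u => by
      have h' : (wt x u : ℤ) < (2 : ℤ) ^ n := by exact_mod_cast wt_lt x u
      have h0 : (0 : ℤ) ≤ wt x u := by exact_mod_cast Nat.zero_le _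
      rw [abs_le]
      constructor <;> linarith
    obtain ⟨Rset, φ, hvR, hcl, hbd⟩ :=
      exists_potential (oddArena o x σ) htot _ (2 ^ n) hB v (cycleCondition_oddArena o v x σ H)
    -- the shifted natural potential, per universe element
    let PhiN : Fin (usize n) → ℕ := fun a => if ha : (a : ℕ) < n then (φ ⟨a, ha⟩ + n * 2 ^ n).toNat else 0
    have hPhiZ : ∀ u : Fin n, 0 ≤ φ u + n * 2 ^ n := fun u => by
      have := hbd u; rw [abs_le] at this; linarith
    have hPhiN_vx : ∀ u : Fin n, ((PhiN (vx u) : ℕ) : ℤ) = φ u + n * 2 ^ n := fun u => by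
      simp only [PhiN, val_vx, dif_pos u.2, Fin.eta]
      exact Int.toNat_of_nonneg (hPhiZ u)
    have hPhiN_le : ∀ a, PhiN a ≤ 2 * (n * 2 ^ n) := fun a => by
      by_cases ha : (a : ℕ) < n
      · have h1 : ((PhiN a : ℕ) : ℤ) = φ ⟨a, ha⟩ + n * 2 ^ n := by
          simp only [PhiN, dif_pos ha]; exact Int.toNat_of_nonneg (hPhiZ _)
        have := hbd ⟨a, ha⟩; rw [abs_le] at this
        have h2 : ((PhiN a : ℕ) : ℤ) ≤ 2 * (n * 2 ^ n) := by rw [h1]; linarith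
        exact_mod_cast h2
      · simp only [PhiN, dif_neg ha]; exact Nat.zero_le _
    have hbud := budget_le n
    have hone : 1 ≤ 2 ^ n := Nat.one_le_two_pow
    -- values of the rows
    have hph : ∀ a, Nat.ofBits (phRowOf PhiN a) = PhiN a := fun a =>
      ofBits_natRow_of_lt (by have := hPhiN_le a; omega)
    have hs1ok : ∀ a, AddOK (phRowOf PhiN a) (pnRow n) (s1RowOf PhiN a)
        (carryRow (phRowOf PhiN a) (pnRow n)) := fun a =>
      addOK_sumRow_carryRow _ _ (by rw [hph, ofBits_pnRow]; have := hPhiN_le a; omega)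
    have hs1 : ∀ a, Nat.ofBits (s1RowOf PhiN a) = PhiN a + 2 ^ n := fun a => by
      rw [(hs1ok a).ofBits_eq, hph, ofBits_pnRow]
    have hw2v : ∀ a, Nat.ofBits (w2TabRow o v x a) ≤ 2 * 2 ^ n - 2 := fun a => by
      by_cases ha : (a : ℕ) < n
      · obtain ⟨u, rfl⟩ := exists_eq_vx (n := n) ha
        rw [show w2TabRow o v x (vx u) = w2Row x u from w2_row_vx_eq o v x u, ofBits_w2Row]
        have := wt_lt x u; omega
      · have : w2TabRow o v x a = fun _ => false := by
          funext j; simp only [w2TabRow]; rw [tab_w2, dif_neg ha]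
        rw [this]
        have h0 : Nat.ofBits (fun _ : Fin (usize n) => false) = 0 := by
          have := ofBits_eq_sum_ite (fun _ : Fin (usize n) => false); simpa using this
        rw [h0]; exact Nat.zero_le _
    have hs2ok : ∀ a, AddOK (phRowOf PhiN a) (w2TabRow o v x a) (s2RowOf o v x PhiN a)
        (carryRow (phRowOf PhiN a) (w2TabRow o v x a)) := fun a =>
      addOK_sumRow_carryRow _ _ (by rw [hph]; have := hPhiN_le a; have := hw2v a; omega)
    have hs2 : ∀ u : Fin n, Nat.ofBits (s2RowOf o v x PhiN (vx u)) = PhiN (vx u) + 2 * wt x u := fun u => by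
      rw [(hs2ok _).ofBits_eq, hph, show w2TabRow o v x (vx u) = w2Row x u from w2_row_vx_eq o v x u,
        ofBits_w2Row]
    refine ⟨witTab o v x σ Rset PhiN, q1_wit o v x σ Rset PhiN hσ, Or.inr ⟨?_, ?_, ?_, ?_⟩⟩
    · -- the start is in the set
      intro a ha
      rw [st_iff] at ha
      rw [rr_wit_iff]
      exact ⟨by rw [ha]; exact v.2, by convert hvR using 1; exact Fin.ext ha⟩
    · -- `S1 = Ph + PN`
      intro a
      exact (addQ_iff_addOK o v x (phRowOf PhiN a) (pnRow n) (s1RowOf PhiN a)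
        (carryRow (phRowOf PhiN a) (pnRow n))).2 (hs1ok a)
    · -- `S2 = Ph + W2`
      intro a
      exact (addQ_iff_addOK o v x (phRowOf PhiN a) (w2TabRow o v x a) (s2RowOf o v x PhiN a)
        (carryRow (phRowOf PhiN a) (w2TabRow o v x a))).2 (hs2ok a)
    · -- edges leaving the set
      intro a b ha hab
      obtain ⟨ha', huR⟩ := (rr_wit_iff o v x σ Rset PhiN a).1 ha
      obtain ⟨u, rfl⟩ := exists_eq_vx (n := n) ha'
      replace huR : u ∈ Rset := by simpa using huR
      have hb : isV (gameTab n o v x) b := hab.2.1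
      obtain ⟨w, rfl⟩ := exists_eq_vx (n := n) ((isV_iff o v x b).1 hb)
      have hE : oddArena o x σ u w := by
        rcases (EP_vx_iff o v x _ u w).1 hab with ⟨hu, hsg, -⟩ | ⟨hu, hx⟩
        · exact Or.inl ⟨hu, (sg_wit_iff o v x σ Rset PhiN u w).1 hsg⟩
        · exact Or.inr ⟨hu, hx⟩
      obtain ⟨hwR, hφ⟩ := hcl u huR w hE
      refine ⟨(rr_wit_vx_iff o v x σ Rset PhiN w).2 hwR, ?_⟩
      -- the inequality `S1 (vx w) ≤ S2 (vx u)`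
      have hle : Nat.ofBits (s1RowOf PhiN (vx w)) ≤ Nat.ofBits (s2RowOf o v x PhiN (vx u)) := by
        rw [hs1, hs2]
        have h1 := hPhiN_vx w
        have h2 := hPhiN_vx u
        have h3 : (φ w : ℤ) ≤ φ u + (2 * (wt x u : ℤ) - 2 ^ n) := hφ
        have : ((PhiN (vx w) + 2 ^ n : ℕ) : ℤ) ≤ ((PhiN (vx u) + 2 * wt x u : ℕ) : ℤ) := by
          push_cast; linarith
        exact_mod_cast this
      -- hence `S1 (vx w) + Dd = S2 (vx u)` is a certified sum
      have hsum : Nat.ofBits (s1RowOf PhiN (vx w)) + Nat.ofBits (ddRowOf o v x PhiN (vx u) (vx w)) =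
          Nat.ofBits (s2RowOf o v x PhiN (vx u)) := by
        rw [ddRowOf, ofBits_natRow_of_lt]
        · omega
        · have := Nat.ofBits_lt_two_pow (s2RowOf o v x PhiN (vx u)); omega
      have hok := addOK_sumRow_carryRow (s1RowOf PhiN (vx w)) (ddRowOf o v x PhiN (vx u) (vx w))
        (by rw [hsum]; exact Nat.ofBits_lt_two_pow _)
      have hrow : sumRow (s1RowOf PhiN (vx w)) (ddRowOf o v x PhiN (vx u) (vx w)) =
          s2RowOf o v x PhiN (vx u) := funext_of_ofBits_eq (by rw [hok.ofBits_eq, hsum])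
      rw [hrow] at hok
      exact (addQ_iff_addOK o v x (s1RowOf PhiN (vx w)) (ddRowOf o v x PhiN (vx u) (vx w))
        (s2RowOf o v x PhiN (vx u)) (carryRow (s1RowOf PhiN (vx w)) (ddRowOf o v x PhiN (vx u) (vx w)))).2 hok

/-- **The certificate is exact**: some witness tables pass the first-order check on the tables
of the game iff Even wins. [cite: ZwickPaterson1996, §2] -/
theorem exists_mpgQ_iff : (∃ W, mpgQ (gameTab n o v x) W) ↔ MpgWin n o v x :=
  ⟨fun ⟨W, hW⟩ => mpgWin_of_mpgQ o v x W hW, mpgQ_of_mpgWin o v x⟩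

end Complete

end Summit.PneNP.PneNP.Theorems.MpgNP
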